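import Mathlib.NumberTheory.ModularForms.EisensteinSeries.E2.Transform
import Mathlib.LinearAlgebra.LinearIndependent.Lemmas
import Mathlib.FieldTheory.IntermediateField.Adjoin.Defs
import Literature.NumberTheory.EllipticCurves.WeierstrassZeta
import HarnessLib

/-!
# Quasi-periods of the Weierstrass zeta function via `G₂`, and the Legendre relation

Topic `Literature/NumberTheory/EllipticCurves` (trunk `TranscendEllArithS`, notion
`weierstrass_zeta_quasi_periods`). This file **discharges** three named facts of
`WeierstrassZeta.lean`:

* `PeriodPair.weierstrassZeta_add_ω₁_holds`, `PeriodPair.weierstrassZeta_add_ω₂_holds` — the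
  quasi-periodicity `ζ(z + ωᵢ) = ζ(z) + ηᵢ` (Whittaker–Watson §20.41);
* `PeriodPair.legendre_relation_holds` — Legendre's relation `η₁ω₂ - η₂ω₁ = 2πi` for a positively
  oriented basis (Whittaker–Watson §20.411),

and derives the orientation-free consequence `2πi ∈ ℚ(ω₁, ω₂, η₁, η₂)`
(`PeriodPair.two_pi_I_mem_periodQuasiPeriodField`), the form in which Legendre's relation enters
Chudnovsky's theorem on periods (`Transcendental/ChudnovskyPeriods.lean`; Chudnovsky 1984, Ch. 7,
§2, p. 305: "according to the Legendre relation `πi ∈ ℚ(ω₁, ω₂, η₁, η₂)`").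

## The proof (Eisenstein's route, not the contour integral of the textbooks)

Let `(a, b)` be an oriented `ℤ`-basis of the lattice, `τ = b/a ∈ ℍ`. The series
`ζ(z) = Σ_l (1/(z-l) + 1/l + z/l²)` converges absolutely for every `z`
(`PeriodPair.hasSum_weierstrassZeta_holds`), hence so does the difference series for
`ζ(z + a) - ζ(z)`, which may therefore be summed line by line (`Summable.tsum_prod`). On the line
`n = const` of `l = ma + nb` the summand is `[f(m-1) - f(m)] + a/l²` with `f(m) = 1/(z - ma - nb)`;
the first part telescopes to `0`, the second gives `a⁻¹ Σ'_m (nτ + m)⁻²`, i.e. `a⁻¹ · e2Summand n τ`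
in the notation of Mathlib's `EisensteinSeries.G2`. Summing over `n`:
`ζ(z + a) - ζ(z) = G₂(τ)/a` for **every** `z` (Eisenstein's formula `η = G₂`). For the shift by
`b` the lines are `m = const` and the iterated sum appears in the *other* order,
`Σ_m Σ'_n (nτ + m)⁻² = τ⁻² G₂(-1/τ)` (Mathlib: `EisensteinSeries.tsum_symmetricIco_tsum_eq_S_act`),
and the failure of absolute convergence of `G₂` is exactly Legendre's relation: by
`EisensteinSeries.G2_S_transform`, `τ⁻² G₂(-1/τ) = G₂(τ) - 2πi/τ`, whence
`ζ(z + b) - ζ(z) = bG₂(τ)/a² - 2πi/a` and `η_a b - η_b a = 2πi`. Both orientations of the basis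
`(ω₁, ω₂)` of a `PeriodPair` are instances (`(a, b) = (ω₁, ω₂)` or `(ω₂, ω₁)`).
(References for this route: A. Weil, *Elliptic functions according to Eisenstein and Kronecker*
(1976), Ch. III–IV; Whittaker–Watson §20.41–20.411 for the statements.)

## Contents (theorems only; no new definitions)

* `zetaSummand_shift_sub`, `tendsto_inv_linear`, `tsum_sub_telescope` — elementary lemmas;
* `weierstrassZeta_add_fst_sub`, `weierstrassZeta_add_snd_sub` — the two Eisenstein formulas for an
  oriented basis `(a, b)` of the lattice;
* `im_ω₂_div_ω₁_pos_or` — one of `(ω₁, ω₂)`, `(ω₂, ω₁)` is oriented;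
* `weierstrassZeta_add_ω₁_eq`, `weierstrassZeta_add_ω₂_eq` (all `z`), the discharges
  `weierstrassZeta_add_ω₁_holds`, `weierstrassZeta_add_ω₂_holds`, `legendre_relation_holds`,
  `legendre_relation_of_neg` (the other orientation), `two_pi_I_mem_periodQuasiPeriodField`.
-/

noncomputable section

open scoped Classical

open UpperHalfPlane hiding I

open Complex Filter Topology EisensteinSeries SummationFilter

namespace PeriodPair

variable (L : PeriodPair)

/-! ### Elementary lemmas -/

/-- Shifting `z` by `a` changes the term of the zeta series at the lattice point `w` by a
telescoping difference plus `a/w²` (valid also at the poles, with the junk conventions `1/0 = 0`).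
[folklore] -/
theorem zetaSummand_shift_sub (z a w : ℂ) :
    (1 / (z + a - w) + 1 / w + (z + a) / w ^ 2) - (1 / (z - w) + 1 / w + z / w ^ 2) =
      ((z - (w - a))⁻¹ - (z - w)⁻¹) + a / w ^ 2 := by
  rw [show z + a - w = z - (w - a) by ring]
  simp only [one_div]
  ring

/-- `1/(a + Nb) → 0` as `N → ∞` (`b ≠ 0`). [folklore] -/
theorem tendsto_inv_linear (a b : ℂ) (hb : b ≠ 0) :
    Tendsto (fun N : ℕ => (a + N * b)⁻¹) atTop (𝓝 0) := by
  refine Filter.tendsto_inv₀_cobounded.comp ?_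
  rw [← tendsto_norm_atTop_iff_cobounded]
  have h1 : Tendsto (fun N : ℕ => (N : ℝ) * ‖b‖ + -‖a‖) atTop atTop :=
    tendsto_atTop_add_const_right _ _
      (tendsto_natCast_atTop_atTop.atTop_mul_const (norm_pos_iff.mpr hb))
  refine tendsto_atTop_mono (fun N => ?_) h1
  have h2 : ‖(N : ℂ) * b‖ ≤ ‖a + N * b‖ + ‖a‖ := by
    calc ‖(N : ℂ) * b‖ = ‖(a + N * b) - a‖ := by ring_nf
      _ ≤ ‖a + N * b‖ + ‖a‖ := norm_sub_le _ _
  have h3 : ‖(N : ℂ) * b‖ = (N : ℝ) * ‖b‖ := by simp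
  linarith

/-- A summable telescoping series over `ℤ` whose terms' primitive tends to `0` at `±∞` sums to
`0`. [folklore] -/
theorem tsum_sub_telescope {f : ℤ → ℂ} (hs : Summable fun m : ℤ => f (m - 1) - f m)
    (h₁ : Tendsto (fun N : ℕ => f N) atTop (𝓝 0))
    (h₂ : Tendsto (fun N : ℕ => f (-(N : ℤ) - 1)) atTop (𝓝 0)) :
    ∑' m, (f (m - 1) - f m) = 0 := by
  rw [← tsum_eq_of_summable_unconditional (L := symmetricIcc ℤ) hs]
  refine HasSum.tsum_eq ?_
  rw [hasSum_symmetricIcc_iff]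
  have key : ∀ N : ℕ,
      ∑ n ∈ Finset.Icc (-(N : ℤ)) N, (f (n - 1) - f n) = f (-(N : ℤ) - 1) - f N := by
    intro N
    induction N with
    | zero => simp
    | succ N ih =>
      rw [show ((N + 1 : ℕ) : ℤ) = (N : ℤ) + 1 by push_cast; ring, Finset.Icc_succ_succ,
        Finset.sum_union, ih, Finset.sum_pair]
      · ring
      · omega
      · simp only [Finset.disjoint_left, Finset.mem_Icc, Finset.mem_insert,
          Finset.mem_singleton]
        omega
  simp_rw [key]
  simpa using h₂.sub h₁

/-! ### Eisenstein's formulas for an oriented basis of the lattice -/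

section basis

variable {L}
variable {a b : ℂ} (e : ℤ × ℤ ≃ L.lattice)

/-- **Eisenstein's formula for the quasi-period of the first basis vector.** If `(a, b)` is a
`ℤ`-basis of the lattice (presented by `e : ℤ × ℤ ≃ Λ`, `e (m, n) = ma + nb`) with
`Im(b/a) > 0`, then for every `z ∈ ℂ`, `ζ(z + a) - ζ(z) = G₂(τ)/a`, `τ = b/a`, where
`G₂(τ) = Σ_n Σ'_m (nτ + m)⁻²` is Mathlib's `EisensteinSeries.G2` (Weil 1976, Ch. IV;
Whittaker–Watson §20.41 for the constancy of the difference). [folklore] -/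
theorem weierstrassZeta_add_fst_sub
    (he : ∀ p : ℤ × ℤ, ((e p : L.lattice) : ℂ) = p.1 * a + p.2 * b) (h : 0 < (b / a).im)
    (z : ℂ) :
    L.weierstrassZeta (z + a) - L.weierstrassZeta z = G2 ⟨b / a, h⟩ / a := by
  set τ : ℍ := ⟨b / a, h⟩ with hτ
  have hτc : (τ : ℂ) = b / a := rfl
  have ha : a ≠ 0 := by
    rintro rfl
    simp at h
  -- the lattice point `ma + nb = a (nτ + m)`
  have hpt : ∀ m n : ℤ, (m : ℂ) * a + n * b = a * (n * (b / a) + m) := fun m n => by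
    field_simp
    ring
  -- index the lattice by `(n, m) ↦ ma + nb`
  let e' : ℤ × ℤ ≃ L.lattice := (Equiv.prodComm ℤ ℤ).trans e
  have he' : ∀ p : ℤ × ℤ, ((e' p : L.lattice) : ℂ) = p.2 * a + p.1 * b := fun p => by
    simp [e', he]
  set F : ℤ × ℤ → ℂ := fun p =>
    (1 / (z + a - (p.2 * a + p.1 * b)) + 1 / (p.2 * a + p.1 * b) +
        (z + a) / (p.2 * a + p.1 * b) ^ 2) -
      (1 / (z - (p.2 * a + p.1 * b)) + 1 / (p.2 * a + p.1 * b) + z / (p.2 * a + p.1 * b) ^ 2)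
    with hF_def
  have h1 := (L.hasSum_weierstrassZeta_holds (z + a)).summable
  have h2 := (L.hasSum_weierstrassZeta_holds z).summable
  have hF : Summable F := by
    refine ((h1.sub h2).comp_injective e'.injective).congr fun p => ?_
    simp [F, he']
  have hdiff : L.weierstrassZeta (z + a) - L.weierstrassZeta z = ∑' p, F p := by
    unfold weierstrassZeta
    rw [← Summable.tsum_sub h1 h2, ← e'.tsum_eq]
    exact tsum_congr fun p => by simp [F, he']
  -- the line sums
  have hB : ∀ n : ℤ, Summable fun m : ℤ => a / ((m : ℂ) * a + n * b) ^ 2 := fun n => by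
    refine ((linear_right_summable (τ : ℂ) n (k := 2) le_rfl).mul_left a⁻¹).congr
      fun m => ?_
    rw [hpt, hτc, zpow_ofNat]
    field_simp
  have hBsum : ∀ n : ℤ, ∑' m : ℤ, a / ((m : ℂ) * a + n * b) ^ 2 = a⁻¹ * e2Summand n τ :=
    fun n => by
    rw [e2Summand, ← tsum_mul_left]
    refine tsum_congr fun m => ?_
    simp only [eisSummand, Fin.isValue, Matrix.cons_val_zero, Matrix.cons_val_one,
      Matrix.cons_val_fin_one, zpow_neg, zpow_ofNat]
    rw [hpt, hτc]
    field_simp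
  have hinner : ∀ n : ℤ, ∑' m : ℤ, F (n, m) = a⁻¹ * e2Summand n τ := fun n => by
    set f : ℤ → ℂ := fun m => (z - (m * a + n * b))⁻¹ with hf
    have hFmn : ∀ m : ℤ, F (n, m) = (f (m - 1) - f m) + a / ((m : ℂ) * a + n * b) ^ 2 := by
      intro m
      simp only [F, f, zetaSummand_shift_sub, Int.cast_sub, Int.cast_one]
      congr 3
      ring
    have hA : Summable fun m : ℤ => f (m - 1) - f m := by
      refine ((hF.prod_factor n).sub (hB n)).congr fun m => ?_
      simp only [hFmn]
      ring
    have htel : ∑' m : ℤ, (f (m - 1) - f m) = 0 := by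
      refine tsum_sub_telescope hA ?_ ?_
      · refine (tendsto_inv_linear (z - n * b) (-a) (neg_ne_zero.mpr ha)).congr fun N => ?_
        simp only [f, Int.cast_natCast]
        ring_nf
      · refine (tendsto_inv_linear (z + a - n * b) a ha).congr fun N => ?_
        simp only [f, Int.cast_sub, Int.cast_neg, Int.cast_natCast, Int.cast_one]
        ring_nf
    calc ∑' m : ℤ, F (n, m)
        = ∑' m : ℤ, ((f (m - 1) - f m) + a / ((m : ℂ) * a + n * b) ^ 2) := tsum_congr hFmn
      _ = 0 + ∑' m : ℤ, a / ((m : ℂ) * a + n * b) ^ 2 := by rw [hA.tsum_add (hB n), htel]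
      _ = a⁻¹ * e2Summand n τ := by rw [zero_add, hBsum]
  -- summing the lines
  have hG : Summable fun n : ℤ => e2Summand n τ := by
    refine ((hF.prod.congr hinner).mul_left a).congr fun n => ?_
    field_simp
  rw [hdiff, hF.tsum_prod, tsum_congr hinner, tsum_mul_left, G2,
    tsum_eq_of_summable_unconditional (L := symmetricIcc ℤ) hG, div_eq_inv_mul]

/-- **Eisenstein's formula for the quasi-period of the second basis vector.** With the hypotheses
of `weierstrassZeta_add_fst_sub`, for every `z ∈ ℂ`,
`ζ(z + b) - ζ(z) = bG₂(τ)/a² - 2πi/a`, `τ = b/a`: here the lattice sum appears in the order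
`Σ_m Σ'_n (nτ + m)⁻² = τ⁻²G₂(-1/τ) = G₂(τ) - 2πi/τ`
(`EisensteinSeries.tsum_symmetricIco_tsum_eq_S_act`, `EisensteinSeries.G2_S_transform`)
(Weil 1976, Ch. IV). [folklore] -/
theorem weierstrassZeta_add_snd_sub
    (he : ∀ p : ℤ × ℤ, ((e p : L.lattice) : ℂ) = p.1 * a + p.2 * b) (h : 0 < (b / a).im)
    (z : ℂ) :
    L.weierstrassZeta (z + b) - L.weierstrassZeta z =
      b * G2 ⟨b / a, h⟩ / a ^ 2 - 2 * Real.pi * I / a := by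
  set τ : ℍ := ⟨b / a, h⟩ with hτ
  have hτc : (τ : ℂ) = b / a := rfl
  have ha : a ≠ 0 := by
    rintro rfl
    simp at h
  have hb : b ≠ 0 := by
    rintro rfl
    simp at h
  have hpt : ∀ m n : ℤ, (m : ℂ) * a + n * b = a * (n * (b / a) + m) := fun m n => by
    field_simp
    ring
  set F : ℤ × ℤ → ℂ := fun p =>
    (1 / (z + b - (p.1 * a + p.2 * b)) + 1 / (p.1 * a + p.2 * b) +
        (z + b) / (p.1 * a + p.2 * b) ^ 2) -
      (1 / (z - (p.1 * a + p.2 * b)) + 1 / (p.1 * a + p.2 * b) + z / (p.1 * a + p.2 * b) ^ 2)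
    with hF_def
  have h1 := (L.hasSum_weierstrassZeta_holds (z + b)).summable
  have h2 := (L.hasSum_weierstrassZeta_holds z).summable
  have hF : Summable F := by
    refine ((h1.sub h2).comp_injective e.injective).congr fun p => ?_
    simp [F, he]
  have hdiff : L.weierstrassZeta (z + b) - L.weierstrassZeta z = ∑' p, F p := by
    unfold weierstrassZeta
    rw [← Summable.tsum_sub h1 h2, ← e.tsum_eq]
    exact tsum_congr fun p => by simp [F, he]
  -- the line sums (over `n`, for fixed `m`)
  have hB : ∀ m : ℤ, Summable fun n : ℤ => b / ((m : ℂ) * a + n * b) ^ 2 := fun m => by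
    refine ((linear_left_summable (ne_zero τ) m (k := 2) le_rfl).mul_left
      (b / a ^ 2)).congr fun n => ?_
    rw [hpt, hτc, zpow_ofNat]
    field_simp
  have hBsum : ∀ m : ℤ, ∑' n : ℤ, b / ((m : ℂ) * a + n * b) ^ 2 =
      b / a ^ 2 * ∑' n : ℤ, 1 / ((n : ℂ) * τ + m) ^ 2 := fun m => by
    rw [← tsum_mul_left]
    refine tsum_congr fun n => ?_
    rw [hpt, hτc]
    field_simp
  have hinner : ∀ m : ℤ, ∑' n : ℤ, F (m, n) =
      b / a ^ 2 * ∑' n : ℤ, 1 / ((n : ℂ) * τ + m) ^ 2 := fun m => by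
    set f : ℤ → ℂ := fun n => (z - (m * a + n * b))⁻¹ with hf
    have hFmn : ∀ n : ℤ, F (m, n) = (f (n - 1) - f n) + b / ((m : ℂ) * a + n * b) ^ 2 := by
      intro n
      simp only [F, f, zetaSummand_shift_sub, Int.cast_sub, Int.cast_one]
      congr 3
      ring
    have hA : Summable fun n : ℤ => f (n - 1) - f n := by
      refine ((hF.prod_factor m).sub (hB m)).congr fun n => ?_
      simp only [hFmn]
      ring
    have htel : ∑' n : ℤ, (f (n - 1) - f n) = 0 := by
      refine tsum_sub_telescope hA ?_ ?_
      · refine (tendsto_inv_linear (z - m * a) (-b) (neg_ne_zero.mpr hb)).congr fun N => ?_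
        simp only [f, Int.cast_natCast]
        ring_nf
      · refine (tendsto_inv_linear (z + b - m * a) b hb).congr fun N => ?_
        simp only [f, Int.cast_sub, Int.cast_neg, Int.cast_natCast, Int.cast_one]
        ring_nf
    calc ∑' n : ℤ, F (m, n)
        = ∑' n : ℤ, ((f (n - 1) - f n) + b / ((m : ℂ) * a + n * b) ^ 2) := tsum_congr hFmn
      _ = 0 + ∑' n : ℤ, b / ((m : ℂ) * a + n * b) ^ 2 := by rw [hA.tsum_add (hB m), htel]
      _ = _ := by rw [zero_add, hBsum]
  -- summing the lines, in Eisenstein's "wrong" order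
  have hc : b / a ^ 2 ≠ 0 := div_ne_zero hb (pow_ne_zero 2 ha)
  have hG : Summable fun m : ℤ => ∑' n : ℤ, 1 / ((n : ℂ) * τ + m) ^ 2 := by
    refine ((hF.prod.congr hinner).mul_left (b / a ^ 2)⁻¹).congr fun m => ?_
    rw [inv_mul_cancel_left₀ hc]
  have hswap : ∑' m : ℤ, ∑' n : ℤ, 1 / ((n : ℂ) * τ + m) ^ 2 = G2 τ - 2 * Real.pi * I / τ := by
    rw [← tsum_eq_of_summable_unconditional (L := symmetricIco ℤ) hG,
      tsum_symmetricIco_tsum_eq_S_act τ, G2_S_transform τ]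
    ring
  rw [hdiff, hF.tsum_prod, tsum_congr hinner, tsum_mul_left, hswap, hτc]
  field_simp

end basis

/-! ### Orientation -/

/-- For a period pair one of the bases `(ω₁, ω₂)`, `(ω₂, ω₁)` is positively oriented:
`Im(ω₂/ω₁) > 0` or `Im(ω₁/ω₂) > 0` (`Im(ω₂/ω₁) ≠ 0` is the `ℝ`-linear independence of
`ω₁, ω₂`). [folklore] -/
theorem im_ω₂_div_ω₁_pos_or : 0 < (L.ω₂ / L.ω₁).im ∨ 0 < (L.ω₁ / L.ω₂).im := by
  have hω₁ : L.ω₁ ≠ 0 := by simpa using L.indep.ne_zero 0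
  have hne : (L.ω₂ / L.ω₁).im ≠ 0 := by
    intro h
    have hq : L.ω₂ / L.ω₁ = (((L.ω₂ / L.ω₁).re : ℝ) : ℂ) := Complex.ext (by simp) (by simp [h])
    have hω : ((L.ω₂ / L.ω₁).re : ℝ) • L.ω₁ + (-1 : ℝ) • L.ω₂ = 0 := by
      rw [real_smul, ← hq, div_mul_cancel₀ _ hω₁]
      simp
    have := (LinearIndependent.pair_iff.mp L.indep _ _ hω).2
    norm_num at this
  rcases lt_or_lt_iff_ne.mpr hne with h | h
  · right
    rw [← inv_div, inv_im]
    have : 0 < normSq (L.ω₂ / L.ω₁) := normSq_pos.mpr fun h0 => by simp [h0] at h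
    exact div_pos (by linarith) this
  · exact Or.inl h

/-- The presentation `e (m, n) = mω₁ + nω₂` of the lattice by its basis. [folklore] -/
theorem coe_latticeEquivProd_symm (p : ℤ × ℤ) :
    ((L.latticeEquivProd.symm.toEquiv p : L.lattice) : ℂ) = p.1 * L.ω₁ + p.2 * L.ω₂ := by
  simp [latticeEquiv_symm_apply]

/-- The presentation `e (m, n) = mω₂ + nω₁` of the lattice by the swapped basis. [folklore] -/
theorem coe_prodComm_latticeEquivProd_symm (p : ℤ × ℤ) :
    ((((Equiv.prodComm ℤ ℤ).trans L.latticeEquivProd.symm.toEquiv) p : L.lattice) : ℂ) =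
      p.1 * L.ω₂ + p.2 * L.ω₁ := by
  simp [latticeEquiv_symm_apply, add_comm]

/-! ### Quasi-periodicity for every `z`, and the discharges -/

/-- `ζ(z + ω₁) = ζ(z) + η₁` for **every** `z ∈ ℂ` (with the junk conventions at lattice points
the identity holds there too). Whittaker–Watson §20.41. [cite: WhittakerWatson1927, §20.41] -/
theorem weierstrassZeta_add_ω₁_eq (z : ℂ) :
    L.weierstrassZeta (z + L.ω₁) = L.weierstrassZeta z + L.η₁ := by
  -- the difference `ζ(z + ω₁) - ζ(z)` is a constant `c`, in either orientation
  obtain ⟨c, hc⟩ : ∃ c : ℂ, ∀ z, L.weierstrassZeta (z + L.ω₁) - L.weierstrassZeta z = c := by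
    rcases L.im_ω₂_div_ω₁_pos_or with h | h
    · exact ⟨_, weierstrassZeta_add_fst_sub _ L.coe_latticeEquivProd_symm h⟩
    · exact ⟨_, weierstrassZeta_add_snd_sub _ L.coe_prodComm_latticeEquivProd_symm h⟩
  -- and `c = ζ(ω₁/2) - ζ(-ω₁/2) = 2ζ(ω₁/2) = η₁`
  have h1 := hc (-(L.ω₁ / 2))
  rw [weierstrassZeta_neg, show -(L.ω₁ / 2) + L.ω₁ = L.ω₁ / 2 by ring] at h1
  have h2 := hc z
  rw [η₁]
  linear_combination h2 - h1

/-- `ζ(z + ω₂) = ζ(z) + η₂` for **every** `z ∈ ℂ`. Whittaker–Watson §20.41.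
[cite: WhittakerWatson1927, §20.41] -/
theorem weierstrassZeta_add_ω₂_eq (z : ℂ) :
    L.weierstrassZeta (z + L.ω₂) = L.weierstrassZeta z + L.η₂ := by
  obtain ⟨c, hc⟩ : ∃ c : ℂ, ∀ z, L.weierstrassZeta (z + L.ω₂) - L.weierstrassZeta z = c := by
    rcases L.im_ω₂_div_ω₁_pos_or with h | h
    · exact ⟨_, weierstrassZeta_add_snd_sub _ L.coe_latticeEquivProd_symm h⟩
    · exact ⟨_, weierstrassZeta_add_fst_sub _ L.coe_prodComm_latticeEquivProd_symm h⟩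
  have h1 := hc (-(L.ω₂ / 2))
  rw [weierstrassZeta_neg, show -(L.ω₂ / 2) + L.ω₂ = L.ω₂ / 2 by ring] at h1
  have h2 := hc z
  rw [η₂]
  linear_combination h2 - h1

/-- Discharge of `PeriodPair.weierstrassZeta_add_ω₁`: `ζ(z + ω₁) = ζ(z) + η₁` (the hypothesis
`z ∉ Λ` of the fact is not needed). Whittaker–Watson §20.41. [cite: WhittakerWatson1927, §20.41] -/
theorem weierstrassZeta_add_ω₁_holds : L.weierstrassZeta_add_ω₁ := fun z _ =>
  L.weierstrassZeta_add_ω₁_eq z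

/-- Discharge of `PeriodPair.weierstrassZeta_add_ω₂`: `ζ(z + ω₂) = ζ(z) + η₂`.
Whittaker–Watson §20.41. [cite: WhittakerWatson1927, §20.41] -/
theorem weierstrassZeta_add_ω₂_holds : L.weierstrassZeta_add_ω₂ := fun z _ =>
  L.weierstrassZeta_add_ω₂_eq z

/-- For a positively oriented pair, `η₁ = G₂(ω₂/ω₁)/ω₁` (Eisenstein; e.g. Weil 1976, Ch. IV).
[folklore] -/
theorem η₁_eq_G2_div (h : 0 < (L.ω₂ / L.ω₁).im) : L.η₁ = G2 ⟨L.ω₂ / L.ω₁, h⟩ / L.ω₁ := by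
  rw [← weierstrassZeta_add_fst_sub _ L.coe_latticeEquivProd_symm h 0,
    L.weierstrassZeta_add_ω₁_eq]
  ring

/-- For a positively oriented pair, `η₂ = ω₂G₂(ω₂/ω₁)/ω₁² - 2πi/ω₁` (Eisenstein; e.g. Weil 1976,
Ch. IV). [folklore] -/
theorem η₂_eq_G2_div (h : 0 < (L.ω₂ / L.ω₁).im) :
    L.η₂ = L.ω₂ * G2 ⟨L.ω₂ / L.ω₁, h⟩ / L.ω₁ ^ 2 - 2 * Real.pi * I / L.ω₁ := by
  rw [← weierstrassZeta_add_snd_sub _ L.coe_latticeEquivProd_symm h 0,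
    L.weierstrassZeta_add_ω₂_eq]
  ring

/-- Discharge of `PeriodPair.legendre_relation`: for a positively oriented basis,
`η₁ω₂ - η₂ω₁ = 2πi` (Whittaker–Watson §20.411; Silverman AEC VI.3.1(c)); proved here by
Eisenstein's route through `G₂(-1/τ) = τ²G₂(τ) - 2πiτ`. [cite: WhittakerWatson1927, §20.411] -/
theorem legendre_relation_holds : L.legendre_relation := fun h => by
  have hω₁ : L.ω₁ ≠ 0 := by simpa using L.indep.ne_zero 0
  rw [L.η₁_eq_G2_div h, L.η₂_eq_G2_div h]
  field_simp
  ring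

/-- Legendre's relation for a negatively oriented basis: if `Im(ω₁/ω₂) > 0` then
`η₂ω₁ - η₁ω₂ = 2πi` (Whittaker–Watson §20.411, with the roles of the periods exchanged).
[cite: WhittakerWatson1927, §20.411] -/
theorem legendre_relation_of_neg (h : 0 < (L.ω₁ / L.ω₂).im) :
    L.η₂ * L.ω₁ - L.η₁ * L.ω₂ = 2 * Real.pi * I := by
  have hω₂ : L.ω₂ ≠ 0 := by simpa using L.indep.ne_zero 1
  have h1 := weierstrassZeta_add_fst_sub _ L.coe_prodComm_latticeEquivProd_symm h 0
  have h2 := weierstrassZeta_add_snd_sub _ L.coe_prodComm_latticeEquivProd_symm h 0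
  rw [L.weierstrassZeta_add_ω₂_eq, add_sub_cancel_left] at h1
  rw [L.weierstrassZeta_add_ω₁_eq, add_sub_cancel_left] at h2
  rw [h1, h2]
  field_simp
  ring

/-- Legendre's relation for an arbitrary basis: `η₁ω₂ - η₂ω₁ = ±2πi`, the sign being that of
`Im(ω₂/ω₁)` (Whittaker–Watson §20.411). [cite: WhittakerWatson1927, §20.411] -/
theorem legendre_relation_up_to_sign :
    L.η₁ * L.ω₂ - L.η₂ * L.ω₁ = 2 * Real.pi * I ∨
      L.η₂ * L.ω₁ - L.η₁ * L.ω₂ = 2 * Real.pi * I := by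
  rcases L.im_ω₂_div_ω₁_pos_or with h | h
  · exact Or.inl (L.legendre_relation_holds h)
  · exact Or.inr (L.legendre_relation_of_neg h)

/-- For every basis `(ω₁, ω₂)` of a lattice, `2πi ∈ ℚ(ω₁, ω₂, η₁, η₂)` (Legendre; this is the
form used by Chudnovsky 1984, Ch. 7, §2, p. 305: "according to the Legendre relation
`πi ∈ ℚ(ω₁, ω₂, η₁, η₂)`"). Unconditional: the Legendre relation is proved above.
[cite: WhittakerWatson1927, §20.411] -/
theorem two_pi_I_mem_periodQuasiPeriodField :
    (2 * Real.pi * I : ℂ) ∈ IntermediateField.adjoin ℚ ({L.ω₁, L.ω₂, L.η₁, L.η₂} : Set ℂ) := by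
  set K := IntermediateField.adjoin ℚ ({L.ω₁, L.ω₂, L.η₁, L.η₂} : Set ℂ)
  have hω₁ : L.ω₁ ∈ K := IntermediateField.subset_adjoin ℚ _ (by simp)
  have hω₂ : L.ω₂ ∈ K := IntermediateField.subset_adjoin ℚ _ (by simp)
  have hη₁ : L.η₁ ∈ K := IntermediateField.subset_adjoin ℚ _ (by simp)
  have hη₂ : L.η₂ ∈ K := IntermediateField.subset_adjoin ℚ _ (by simp)
  rcases L.legendre_relation_up_to_sign with h | h <;> rw [← h]
  · exact sub_mem (mul_mem hη₁ hω₂) (mul_mem hη₂ hω₁)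
  · exact sub_mem (mul_mem hη₂ hω₁) (mul_mem hη₁ hω₂)

end PeriodPair

end
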